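import Summits.Langlands.Langlands.Theses.PicardMuOrdinary
import Literature.NumberTheory.Automorphic.ClozelAlgebraicityComplexConjArch

/-!
# `IrregularClassicality` (stmt-Langlands-13758) — Negative knowledge II: the `∃ e` over complex
# embeddings of `ℚ(ω)` in the conclusion (= the target `PicardAutomorphy`'s conclusion) is innocuous

From the standing disprover's `Cruxes/IrregularClassicality/Disproof.lean` (cdisprove cycle 1,
2026-08-16).  The common conclusion of the crux and of the target reads
`∃ (e : ℚ(ω) →+* ℂ) (π cuspidal L-algebraic), Σ Satake(π, 𝔭) = e(a_𝔭(f))` for almost all `𝔭`.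
A disprover must ask whether the existential over the two embeddings hides a sign / conjugation
convention.  It does not: `π ↦ π̄` (the tree's complex-conjugate representation
`CuspidalAutomorphicRepData.conj`, with `HasSatakeParamAt.conj` and `HasInfinityType.conj`)
exchanges the two choices, so the conclusion is equivalent to its version with ANY FIXED embedding
`e₀` (`automorphyConclusion_iff_fixed`).  Provers of either item may therefore fix `e₀`.

* `not_isReal` — `ℚ(ω) = CyclotomicField 3 ℚ` has no real embedding;
* `embedding_eq_or_eq_conjugate` — its embeddings are `e₀` and `ē₀`;
* `conclusion_conj` — `(e, π) ↦ (ē, π̄)` transports the conclusion;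
* `automorphyConclusion_iff_fixed` — the `∃ e` may be replaced by a fixed `e₀`.

Mathlib + the route file + `ClozelAlgebraicityComplexConjArch` only. [folklore]
-/

set_option linter.dupNamespace false

namespace Summit.Langlands.Langlands.Theorems.IrregularClassicality.Negative

open Literature.NumberTheory.Automorphic Literature.NumberTheory.GaloisRepresentations
open NumberField IsDedekindDomain Polynomial Filter

open scoped Classical

/-- `ℚ(ω)` has no real embedding (a real cube root of unity is `1`). [folklore] -/
theorem not_isReal (e : CyclotomicField 3 ℚ →+* ℂ) : ¬ ComplexEmbedding.IsReal e := by
  haveI : IsCyclotomicExtension {3} ℚ (CyclotomicField 3 ℚ) :=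
    CyclotomicField.isCyclotomicExtension 3 ℚ
  intro h
  have hζ := IsCyclotomicExtension.zeta_spec 3 ℚ (CyclotomicField 3 ℚ)
  set z : ℂ := e (IsCyclotomicExtension.zeta 3 ℚ (CyclotomicField 3 ℚ)) with hzdef
  have hz : IsPrimitiveRoot z 3 := hζ.map_of_injective e.injective
  have hreal : (starRingEnd ℂ) z = z := by
    have := RingHom.congr_fun (ComplexEmbedding.isReal_iff.1 h)
      (IsCyclotomicExtension.zeta 3 ℚ (CyclotomicField 3 ℚ))
    rwa [ComplexEmbedding.conjugate_coe_eq] at this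
  have h3 : z ^ 3 = 1 := hz.pow_eq_one
  have h1 : z ≠ 1 := hz.ne_one (by norm_num)
  have him : z.im = 0 := Complex.conj_eq_iff_im.1 hreal
  have hq : z ^ 2 + z + 1 = 0 := by
    have : (z - 1) * (z ^ 2 + z + 1) = 0 := by linear_combination h3
    exact (mul_eq_zero.1 this).resolve_left (sub_ne_zero.2 h1)
  have hzx : z = (z.re : ℂ) := Complex.ext (by simp) (by simp [him])
  rw [hzx] at hq
  have hq' : z.re ^ 2 + z.re + 1 = 0 := by exact_mod_cast hq
  nlinarith [sq_nonneg (z.re + 1 / 2)]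

/-- `ℚ(ω)` has exactly two complex embeddings: every `e` is `e₀` or `ē₀`
(`#(K →+* ℂ) = [K : ℚ] = φ(3) = 2` and `ē₀ ≠ e₀`). [folklore] -/
theorem embedding_eq_or_eq_conjugate (e e₀ : CyclotomicField 3 ℚ →+* ℂ) :
    e = e₀ ∨ e = ComplexEmbedding.conjugate e₀ := by
  haveI : IsCyclotomicExtension {3} ℚ (CyclotomicField 3 ℚ) :=
    CyclotomicField.isCyclotomicExtension 3 ℚ
  have hcard : Fintype.card (CyclotomicField 3 ℚ →+* ℂ) = 2 := by
    rw [NumberField.Embeddings.card]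
    have h := IsCyclotomicExtension.Rat.finrank 3 (CyclotomicField 3 ℚ)
    rw [Nat.totient_prime Nat.prime_three] at h
    convert h using 2
  have hne : e₀ ≠ ComplexEmbedding.conjugate e₀ := fun h =>
    not_isReal e₀ (ComplexEmbedding.isReal_iff.2 h.symm)
  have huniv : ({e₀, ComplexEmbedding.conjugate e₀} : Finset (CyclotomicField 3 ℚ →+* ℂ)) =
      Finset.univ :=
    Finset.eq_univ_of_card _ (by rw [Finset.card_pair hne, hcard])
  have hmem : e ∈ ({e₀, ComplexEmbedding.conjugate e₀} : Finset (CyclotomicField 3 ℚ →+* ℂ)) :=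
    huniv ▸ Finset.mem_univ e
  simpa [Finset.mem_insert, Finset.mem_singleton] using hmem

/-- **Conjugation transports the conclusion of `IrregularClassicality` / `PicardAutomorphy`**: if
the cuspidal `π` is L-algebraic with `Σ Satake(π, 𝔭) = e(a_𝔭(f))` a.e., then `π̄` is L-algebraic
(infinity type `T̄`, `HasInfinityType.conj`) with `Σ Satake(π̄, 𝔭) = ē(a_𝔭(f))` a.e.
(`HasSatakeParamAt.conj`: the Satake parameter of `π̄` is `ᾱ`). [folklore] -/
theorem conclusion_conj {f : ℤ[X]} {hcpt : isCompact_glFiniteIntegralLevel 3 (CyclotomicField 3 ℚ)}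
    {e : CyclotomicField 3 ℚ →+* ℂ} {π : CuspidalAutomorphicRepData 3 (CyclotomicField 3 ℚ) hcpt}
    (hL : π.1.IsLAlgebraic)
    (h : ∀ᶠ 𝔭 : HeightOneSpectrum (𝓞 (CyclotomicField 3 ℚ)) in cofinite, ∃ α : Multiset ℂ,
      π.1.HasSatakeParamAt 𝔭 α ∧ α.sum = e (picardTrace f 𝔭)) :
    π.conj.1.IsLAlgebraic ∧
      ∀ᶠ 𝔭 : HeightOneSpectrum (𝓞 (CyclotomicField 3 ℚ)) in cofinite, ∃ α : Multiset ℂ,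
        π.conj.1.HasSatakeParamAt 𝔭 α ∧ α.sum = ComplexEmbedding.conjugate e (picardTrace f 𝔭) := by
  constructor
  · obtain ⟨T, hT, hLT⟩ := hL
    refine ⟨T.conjType, ?_, fun ι p hp => ?_⟩
    · rw [CuspidalAutomorphicRepData.conj_val]
      exact AutomorphicRepData.HasInfinityType.conj π.1 hT
    · rw [InfinityType.conjType_apply, Multiset.mem_map] at hp
      obtain ⟨p₀, hp₀, rfl⟩ := hp
      obtain ⟨k, l, hk, hl⟩ := hLT ι p₀ hp₀
      exact ⟨l, k, by simp [hl], by simp [hk]⟩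
  · refine h.mono fun 𝔭 h𝔭 => ?_
    obtain ⟨α, hα, hsum⟩ := h𝔭
    refine ⟨α.map (starRingEnd ℂ), ?_, ?_⟩
    · rw [CuspidalAutomorphicRepData.conj_val]
      exact AutomorphicRepData.HasSatakeParamAt.conj hα
    · rw [← map_multiset_sum, hsum, ComplexEmbedding.conjugate_coe_eq]

/-- **The `∃ e` of the conclusion may be fixed in advance.**  For either embedding `e₀` of `ℚ(ω)`
and every `f`, the conclusion of `IrregularClassicality` (verbatim that of `PicardAutomorphy`)
holds iff there is a cuspidal L-algebraic `π` on `GL₃(𝔸_{ℚ(ω)})` with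
`Σ Satake(π, 𝔭) = e₀(a_𝔭(f))` for almost all `𝔭`.  The existential over embeddings hides no
convention; provers may aim at a fixed `e₀`. [folklore] -/
theorem automorphyConclusion_iff_fixed (e₀ : CyclotomicField 3 ℚ →+* ℂ) (f : ℤ[X])
    (hcpt : isCompact_glFiniteIntegralLevel 3 (CyclotomicField 3 ℚ)) :
    (∃ (e : CyclotomicField 3 ℚ →+* ℂ) (π : CuspidalAutomorphicRepData 3 (CyclotomicField 3 ℚ) hcpt),
        π.1.IsLAlgebraic ∧
        ∀ᶠ 𝔭 : HeightOneSpectrum (𝓞 (CyclotomicField 3 ℚ)) in cofinite, ∃ α : Multiset ℂ,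
          π.1.HasSatakeParamAt 𝔭 α ∧ α.sum = e (picardTrace f 𝔭)) ↔
      ∃ π : CuspidalAutomorphicRepData 3 (CyclotomicField 3 ℚ) hcpt, π.1.IsLAlgebraic ∧
        ∀ᶠ 𝔭 : HeightOneSpectrum (𝓞 (CyclotomicField 3 ℚ)) in cofinite, ∃ α : Multiset ℂ,
          π.1.HasSatakeParamAt 𝔭 α ∧ α.sum = e₀ (picardTrace f 𝔭) := by
  constructor
  · rintro ⟨e, π, hL, h⟩
    rcases embedding_eq_or_eq_conjugate e e₀ with rfl | rfl
    · exact ⟨π, hL, h⟩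
    · obtain ⟨hL', h'⟩ := conclusion_conj hL h
      have hee : ComplexEmbedding.conjugate (ComplexEmbedding.conjugate e₀) = e₀ := star_star e₀
      rw [hee] at h'
      exact ⟨π.conj, hL', h'⟩
  · rintro ⟨π, hL, h⟩
    exact ⟨e₀, π, hL, h⟩

/-- **The limit hypothesis of `IrregularClassicality` is conjugation-symmetric too**: a tower at
the embedding `e` gives a tower at `ē` — conjugate the `P_k` (`IsRegularAlgebraic.conj`,
`HasSatakeParamAt.conj`), replace `𝔐 ⊂ ℤ̄` by its conjugate and `t, u` by `t̄, ū` (complex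
conjugation preserves `ℤ̄ = integralClosure ℤ ℂ`). [folklore] -/
theorem limitHypothesis_conj {f : ℤ[X]} {hcpt : isCompact_glFiniteIntegralLevel 3 (CyclotomicField 3 ℚ)}
    {e : CyclotomicField 3 ℚ →+* ℂ}
    (h : ∃ (𝔐 : Ideal (integralClosure ℤ ℂ))
      (S : Finset (HeightOneSpectrum (𝓞 (CyclotomicField 3 ℚ)))), 𝔐.IsMaximal ∧
      (3 : integralClosure ℤ ℂ) ∈ 𝔐 ∧ ∀ k : ℕ,
      ∃ P : CuspidalAutomorphicRepData 3 (CyclotomicField 3 ℚ) hcpt, P.1.IsRegularAlgebraic ∧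
        ∀ 𝔭 ∉ S, ∃ (α : Multiset ℂ) (t u : integralClosure ℤ ℂ), P.1.HasSatakeParamAt 𝔭 α ∧
          (t : ℂ) = (𝔭.residueCard : ℂ) * α.sum - e (picardTrace f 𝔭) ∧ u ∉ 𝔐 ∧
          u * t ∈ Ideal.span {(3 : integralClosure ℤ ℂ) ^ k}) :
    ∃ (𝔐 : Ideal (integralClosure ℤ ℂ))
      (S : Finset (HeightOneSpectrum (𝓞 (CyclotomicField 3 ℚ)))), 𝔐.IsMaximal ∧
      (3 : integralClosure ℤ ℂ) ∈ 𝔐 ∧ ∀ k : ℕ,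
      ∃ P : CuspidalAutomorphicRepData 3 (CyclotomicField 3 ℚ) hcpt, P.1.IsRegularAlgebraic ∧
        ∀ 𝔭 ∉ S, ∃ (α : Multiset ℂ) (t u : integralClosure ℤ ℂ), P.1.HasSatakeParamAt 𝔭 α ∧
          (t : ℂ) = (𝔭.residueCard : ℂ) * α.sum -
            ComplexEmbedding.conjugate e (picardTrace f 𝔭) ∧ u ∉ 𝔐 ∧
          u * t ∈ Ideal.span {(3 : integralClosure ℤ ℂ) ^ k} := by
  -- complex conjugation on `ℤ̄`
  let c : integralClosure ℤ ℂ →ₐ[ℤ] integralClosure ℤ ℂ :=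
    ((starRingEnd ℂ).toIntAlgHom.comp (integralClosure ℤ ℂ).val).codRestrict (integralClosure ℤ ℂ)
      fun x => (mem_integralClosure_iff ℤ ℂ).2
        (((mem_integralClosure_iff ℤ ℂ).1 x.2).map (starRingEnd ℂ).toIntAlgHom)
  have hc : ∀ x, (c x : ℂ) = starRingEnd ℂ x := fun x => rfl
  have hcc : ∀ x, c (c x) = x := fun x => Subtype.ext (by rw [hc, hc]; exact Complex.conj_conj _)
  have hcs : Function.Surjective c := fun x => ⟨c x, hcc x⟩
  obtain ⟨𝔐, S, h𝔐, h3, h⟩ := h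
  refine ⟨𝔐.comap c, S, Ideal.comap_isMaximal_of_surjective _ hcs,
    by rw [Ideal.mem_comap, map_ofNat]; exact h3, fun k => ?_⟩
  obtain ⟨P, hP, hk⟩ := h k
  refine ⟨P.conj, ?_, fun 𝔭 h𝔭 => ?_⟩
  · rw [CuspidalAutomorphicRepData.conj_val]
    exact AutomorphicRepData.IsRegularAlgebraic.conj P.1 hP
  · obtain ⟨α, t, u, hα, ht, hu, hut⟩ := hk 𝔭 h𝔭
    refine ⟨α.map (starRingEnd ℂ), c t, c u, ?_, ?_, ?_, ?_⟩
    · rw [CuspidalAutomorphicRepData.conj_val]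
      exact AutomorphicRepData.HasSatakeParamAt.conj hα
    · rw [hc, ht, map_sub, map_mul, map_natCast, ← map_multiset_sum,
        ComplexEmbedding.conjugate_coe_eq]
    · rwa [Ideal.mem_comap, hcc]
    · rw [Ideal.mem_span_singleton] at hut ⊢
      obtain ⟨r, hr⟩ := hut
      exact ⟨c r, by rw [← map_mul, hr, map_mul, map_pow, map_ofNat]⟩

/-- **NORMAL FORM of the crux with ONE fixed embedding on both sides.**  For either embedding
`e₀` of `ℚ(ω)`: `IrregularClassicality` ↔ for every generic quartic `f`, a `3`-adic tower of
regular algebraic cuspidal `P_k` with `N𝔭·Σα(P_k,𝔭) ≡ e₀(a_𝔭(f))` gives a cuspidal L-algebraic `π`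
with `Σα(π,𝔭) = e₀(a_𝔭(f))` a.e.  So the two independent existentials over embeddings (one in
the hypothesis, one in the conclusion) can neither be played against each other by a disprover
nor burden a prover. [folklore] -/
theorem irregularClassicality_iff_fixed (e₀ : CyclotomicField 3 ℚ →+* ℂ) :
    Summit.Langlands.Langlands.Theses.PicardMuOrdinary.IrregularClassicality ↔
      ∀ (f : ℤ[X]) (hcpt : isCompact_glFiniteIntegralLevel 3 (CyclotomicField 3 ℚ)),
        f.natDegree = 4 → (f.map (Int.castRingHom ℚ)).Separable →
        12 ∣ Nat.card (f.map (Int.castRingHom ℚ)).Gal →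
        (∃ (𝔐 : Ideal (integralClosure ℤ ℂ))
          (S : Finset (HeightOneSpectrum (𝓞 (CyclotomicField 3 ℚ)))), 𝔐.IsMaximal ∧
          (3 : integralClosure ℤ ℂ) ∈ 𝔐 ∧ ∀ k : ℕ,
          ∃ P : CuspidalAutomorphicRepData 3 (CyclotomicField 3 ℚ) hcpt, P.1.IsRegularAlgebraic ∧
            ∀ 𝔭 ∉ S, ∃ (α : Multiset ℂ) (t u : integralClosure ℤ ℂ), P.1.HasSatakeParamAt 𝔭 α ∧
              (t : ℂ) = (𝔭.residueCard : ℂ) * α.sum - e₀ (picardTrace f 𝔭) ∧ u ∉ 𝔐 ∧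
              u * t ∈ Ideal.span {(3 : integralClosure ℤ ℂ) ^ k}) →
        ∃ π : CuspidalAutomorphicRepData 3 (CyclotomicField 3 ℚ) hcpt, π.1.IsLAlgebraic ∧
          ∀ᶠ 𝔭 : HeightOneSpectrum (𝓞 (CyclotomicField 3 ℚ)) in cofinite, ∃ α : Multiset ℂ,
            π.1.HasSatakeParamAt 𝔭 α ∧ α.sum = e₀ (picardTrace f 𝔭) := by
  unfold Summit.Langlands.Langlands.Theses.PicardMuOrdinary.IrregularClassicality
  refine forall₂_congr fun f hcpt => ?_
  refine imp_congr_right fun _ => imp_congr_right fun _ => imp_congr_right fun _ => ?_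
  rw [← automorphyConclusion_iff_fixed e₀ f hcpt]
  refine ⟨fun H hlim => H ⟨e₀, hlim⟩, fun H hlim => ?_⟩
  obtain ⟨e, hlim⟩ := hlim
  rcases embedding_eq_or_eq_conjugate e e₀ with rfl | rfl
  · exact H hlim
  · have h' := limitHypothesis_conj hlim
    rw [show ComplexEmbedding.conjugate (ComplexEmbedding.conjugate e₀) = e₀ from star_star e₀] at h'
    exact H h'

end Summit.Langlands.Langlands.Theorems.IrregularClassicality.Negative
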